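import Mathlib
import Summits.ValiantsHypothesis.ValiantsHypothesis.Theorems.NewtonUnitEquationsDissociatedUniformTotalsLaw
import HarnessLib

/-!
# Crux `NewtonUnitEquations.DissociatedUniform` (stmt-ValiantsHypothesis-5905): the `n = 3` totals law — the AVERAGE VALUE-DEPTH LEMMA
# (tops of the classes are shallow ON AVERAGE at every weight)

Companion of `…DissociatedUniformTotalsLaw` (memo L5 `le_of_wins_all`: full multiplicity forces a top fibre) and of the shallow/deep
dichotomy `…TotalsLawShallowAll` / `…KShallowAll` (the law ⟺ deep vertices are `O(q²)`).  Fix a weight and write `α, β, γ : G → ℝ` for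
the scores of the three alphabets, `x₁, y₁, z₁` for (any) letters and `(X s, Y s, Z s)` for a top word of class `s`
(no word `(x, y, s − x − y)` of the class scores more; the lemmas do not even need `X s + Y s + Z s = s`, which `exists_tops` provides).  The GAPS `α x₁ − α (X s)` etc. measure how far below the letter `x₁` the
top of class `s` reads its first letter (value-depth; `≥ 0` when `x₁` is the top letter).  PROVED (pure bookkeeping over the group,
no geometry):
* **`sum_gap_add_gap_le`** — `∑_s [(α x₁ − α (X s)) + (β y₁ − β (Y s))] ≤ ∑_s γ (Z s) − ∑_z γ z`: compare each class top with the
  word `(x₁, y₁, s − x₁ − y₁)` of its class and use that `s ↦ s − x₁ − y₁` is a bijection of `G`;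
* **`sum_gaps_le`** — `∑_s [(α x₁ − α (X s)) + (β y₁ − β (Y s)) + (γ z₁ − γ (Z s))] ≤ |G|·γ z₁ − ∑_z γ z` (`= |G|·(γ z₁ − mean γ)`, the
  centroid half-width of `C` at the weight when `z₁` is its top letter), and by symmetry (`sum_gaps_le_left`, `sum_gaps_le_mid`) the same
  with `A` or `B` on the right: **the total value-depth of the `|G|` class tops at any weight is at most `|G|` times the SMALLEST of the
  three centroid half-widths**.  Consequences: a negligible alphabet forces every top to read the top letters of the other two (the
  `c`-tiny regime); `k`-deep tops at a weight number at most `|G|·min W / (δ_A^k + δ_B^k + δ_C^k)` (`δ^k` = score gap between the best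
  and the `(k+1)`-st letter) — memo `Cruxes/DissociatedUniform/NOTES-t1g11.md` §3.
Honest label: an unconditional averaging identity; the law remains OPEN; nothing here bears on VP ≠ VNP.
[folklore]
-/

set_option linter.dupNamespace false -- `ValiantsHypothesis.ValiantsHypothesis` (summit = problem) in every name

open scoped BigOperators

namespace Summit.ValiantsHypothesis.ValiantsHypothesis.Theorems.NewtonUnitEquationsDissociatedUniform

namespace TotalsLaw

variable {G : Type*} [AddCommGroup G] [Fintype G]

/-- **Average value-depth, two letters.**  If `(X s, Y s, Z s)` is a top word of class `s` for the scores `α, β, γ` (for every `s`),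
then `∑_s [(α x₁ − α (X s)) + (β y₁ − β (Y s))] ≤ ∑_s γ (Z s) − ∑_z γ z` for ANY letters `x₁, y₁`. [folklore] -/
theorem sum_gap_add_gap_le (α β γ : G → ℝ) (x₁ y₁ : G) (X Y Z : G → G)
    (hmax : ∀ s x y : G, α x + β y + γ (s - x - y) ≤ α (X s) + β (Y s) + γ (Z s)) :
    ∑ s, ((α x₁ - α (X s)) + (β y₁ - β (Y s))) ≤ ∑ s, γ (Z s) - ∑ z, γ z := by
  have hre : ∑ s, γ (s - x₁ - y₁) = ∑ z, γ z := by
    have : (fun s : G => γ (s - x₁ - y₁)) = fun s => γ (s - (x₁ + y₁)) := by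
      funext s; rw [sub_sub]
    rw [this]
    exact Equiv.sum_comp (Equiv.subRight (x₁ + y₁)) γ
  have hcls : ∀ s, α x₁ + β y₁ + γ (s - x₁ - y₁) ≤ α (X s) + β (Y s) + γ (Z s) := fun s => hmax s x₁ y₁
  have h := Finset.sum_le_sum fun s (_ : s ∈ (Finset.univ : Finset G)) => hcls s
  have e1 : ∑ s, ((α x₁ - α (X s)) + (β y₁ - β (Y s))) =
      (∑ s, (α x₁ + β y₁ + γ (s - x₁ - y₁)) - ∑ s, (α (X s) + β (Y s) + γ (Z s))) +
        (∑ s, γ (Z s) - ∑ s, γ (s - x₁ - y₁)) := by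
    rw [← Finset.sum_sub_distrib, ← Finset.sum_sub_distrib, ← Finset.sum_add_distrib]
    exact Finset.sum_congr rfl fun s _ => by ring
  rw [e1, hre]
  linarith

/-- **Average value-depth lemma.**  With `z₁` any letter as well:
`∑_s [(α x₁ − α (X s)) + (β y₁ − β (Y s)) + (γ z₁ − γ (Z s))] ≤ |G|·γ z₁ − ∑_z γ z` — the total value-depth of the class tops is at
most `|G|` times the excess of `γ z₁` over the mean of `γ` (the centroid half-width of `C` when `z₁` is its top letter). [folklore] -/
theorem sum_gaps_le (α β γ : G → ℝ) (x₁ y₁ z₁ : G) (X Y Z : G → G)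
    (hmax : ∀ s x y : G, α x + β y + γ (s - x - y) ≤ α (X s) + β (Y s) + γ (Z s)) :
    ∑ s, ((α x₁ - α (X s)) + (β y₁ - β (Y s)) + (γ z₁ - γ (Z s))) ≤ Fintype.card G * γ z₁ - ∑ z, γ z := by
  have h := sum_gap_add_gap_le α β γ x₁ y₁ X Y Z hmax
  have e : ∑ s, ((α x₁ - α (X s)) + (β y₁ - β (Y s)) + (γ z₁ - γ (Z s))) =
      ∑ s, ((α x₁ - α (X s)) + (β y₁ - β (Y s))) + (Fintype.card G * γ z₁ - ∑ s, γ (Z s)) := by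
    rw [Finset.sum_add_distrib, Finset.sum_sub_distrib, Finset.sum_const, Finset.card_univ, nsmul_eq_mul]
  rw [e]
  linarith

/-- The same with the FIRST alphabet on the right: `∑_s [gaps] ≤ |G|·α x₁ − ∑_x α x` (compare with the words `(s − y₁ − z₁, y₁, z₁)`).
[folklore] -/
theorem sum_gaps_le_left (α β γ : G → ℝ) (x₁ y₁ z₁ : G) (X Y Z : G → G)
    (hmax : ∀ s x y : G, α x + β y + γ (s - x - y) ≤ α (X s) + β (Y s) + γ (Z s)) :
    ∑ s, ((α x₁ - α (X s)) + (β y₁ - β (Y s)) + (γ z₁ - γ (Z s))) ≤ Fintype.card G * α x₁ - ∑ x, α x := by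
  -- rotate the roles: tops `(Y s, Z s, X s)` for the scores `β, γ, α`
  have hmax' : ∀ s y z : G, β y + γ z + α (s - y - z) ≤ β (Y s) + γ (Z s) + α (X s) := by
    intro s y z
    have h := hmax s (s - y - z) y
    have e : s - (s - y - z) - y = z := by abel
    rw [e] at h
    linarith
  have h := sum_gaps_le β γ α y₁ z₁ x₁ Y Z X hmax'
  calc ∑ s, ((α x₁ - α (X s)) + (β y₁ - β (Y s)) + (γ z₁ - γ (Z s)))
      = ∑ s, ((β y₁ - β (Y s)) + (γ z₁ - γ (Z s)) + (α x₁ - α (X s))) := Finset.sum_congr rfl fun s _ => by ring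
    _ ≤ _ := h

/-- … and with the SECOND alphabet on the right: `∑_s [gaps] ≤ |G|·β y₁ − ∑_y β y`. [folklore] -/
theorem sum_gaps_le_mid (α β γ : G → ℝ) (x₁ y₁ z₁ : G) (X Y Z : G → G)
    (hmax : ∀ s x y : G, α x + β y + γ (s - x - y) ≤ α (X s) + β (Y s) + γ (Z s)) :
    ∑ s, ((α x₁ - α (X s)) + (β y₁ - β (Y s)) + (γ z₁ - γ (Z s))) ≤ Fintype.card G * β y₁ - ∑ y, β y := by
  have hmax' : ∀ s z x : G, γ z + α x + β (s - z - x) ≤ γ (Z s) + α (X s) + β (Y s) := by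
    intro s z x
    have h := hmax s x (s - z - x)
    have e : s - x - (s - z - x) = z := by abel
    rw [e] at h
    linarith
  have h := sum_gaps_le γ α β z₁ x₁ y₁ Z X Y hmax'
  calc ∑ s, ((α x₁ - α (X s)) + (β y₁ - β (Y s)) + (γ z₁ - γ (Z s)))
      = ∑ s, ((γ z₁ - γ (Z s)) + (α x₁ - α (X s)) + (β y₁ - β (Y s))) := Finset.sum_congr rfl fun s _ => by ring
    _ ≤ _ := h

/-- **Tops exist**: for scores `α, β, γ` every class has a top word (finite maximum), packaged as choice functions. [folklore] -/
theorem exists_tops (α β γ : G → ℝ) :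
    ∃ X Y Z : G → G, (∀ s, X s + Y s + Z s = s) ∧
      ∀ s x y : G, α x + β y + γ (s - x - y) ≤ α (X s) + β (Y s) + γ (Z s) := by
  classical
  have hne : (Finset.univ : Finset (G × G)).Nonempty := ⟨(0, 0), Finset.mem_univ _⟩
  have hex : ∀ s : G, ∃ p : G × G, ∀ p' : G × G,
      α p'.1 + β p'.2 + γ (s - p'.1 - p'.2) ≤ α p.1 + β p.2 + γ (s - p.1 - p.2) := by
    intro s
    obtain ⟨p, -, hp⟩ := Finset.exists_max_image Finset.univ (fun p : G × G => α p.1 + β p.2 + γ (s - p.1 - p.2)) hne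
    exact ⟨p, fun p' => hp p' (Finset.mem_univ _)⟩
  choose P hP using hex
  refine ⟨fun s => (P s).1, fun s => (P s).2, fun s => s - (P s).1 - (P s).2, fun s => by dsimp only; abel, fun s x y => ?_⟩
  exact hP s (x, y)

end TotalsLaw

end Summit.ValiantsHypothesis.ValiantsHypothesis.Theorems.NewtonUnitEquationsDissociatedUniform
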